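import Summits.QuantumAdvantage.AdviceFreeQNC0.BlockParityChar
import Summits.QuantumAdvantage.AdviceFreeQNC0.DWalkOneBell
import HarnessLib

/-!
# Cell qa-qnc0 (rung F-Q2-odd, `p = 3`): LEMMA S — `MOD₃` of block parities vs low-degree `𝔽₃`-polynomials

Planner qa-qnc0-p1 g16, `ROUND-15.md` §3.6 (formalisation map L6), for THEOREM A′ `PredHardDWB3`.  With the tools of
`BlockParityChar.lean` (blocks, Walsh inversion, the signed Smolensky correlation bound `abs_signed_corr_le`) and the
affine count `three_mul_card_affine_zmod3` (`DWalkOneBell.lean`):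

* `three_mul_card_tau_le` — `3·#{q ∈ {0,1}^K : τ(q) = t} ≤ 2^K + 2` (`τ(q) = t₀ + Σ η_j(−1)^{q_j}` is affine in `q`
  with non-zero coefficients, `−η = 2η` in `𝔽₃`);
* **`card_agree_target_le`** (LEMMA S): for `η_j ≠ 0`, `ℓ ≥ 1`, `F` of degree `≤ D` on `{0,1}^{Kℓ}`,
  `#{c : F(c) = t₀ + Σ_j η_j (−1)^{p_j(c)}} ≤ 2^{Kℓ}·(1/3 + (2/3)·2^{−K} + 6·2^K·D/√ℓ)`.

WHAT THIS IS NOT: no statement about the D-walk itself; separation NOT moved.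
-/

noncomputable section

namespace Summit.QuantumAdvantage.AdviceFreeQNC0

namespace BlockParity

open Finset
open Literature.Computability.MetaComplexity Literature.Computability.MetaComplexity.Smolensky

variable {K ℓ : ℕ}

/-! ### LEMMA S -/

/-- The number of parity patterns with `τ = t` is at most `(2^K + 2)/3`. -/
theorem three_mul_card_tau_le (t₀ : ZMod 3) (η : Fin K → ZMod 3) (hη : ∀ j, η j ≠ 0) (t : ZMod 3) :
    3 * ((univ.filter fun q : Fin K → Bool => tau t₀ η q = t).card : ℝ) ≤ (2 : ℝ) ^ K + 2 := by
  have h := (three_mul_card_affine_zmod3 K η hη (t₀ + ∑ j, η j) t).2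
  have hset : (univ.filter fun q : Fin K → Bool => tau t₀ η q = t) =
      univ.filter fun q : Fin K → Bool => t₀ + ∑ j, η j + ∑ j, (if q j = true then η j else 0) = t := by
    ext q
    simp only [mem_filter, mem_univ, true_and, tau]
    have : t₀ + ∑ j, η j * (if q j = true then -1 else 1) = t₀ + ∑ j, η j + ∑ j, (if q j = true then η j else 0) := by
      rw [add_assoc, ← Finset.sum_add_distrib]
      congr 1
      refine Finset.sum_congr rfl fun j _ => ?_
      have h3 : (3 : ZMod 3) = 0 := by decide
      split_ifs
      · linear_combination (-(η j)) * h3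
      · ring
    rw [this]
  rw [hset]
  exact_mod_cast h

/-- **LEMMA S** (ROUND-15 §3.6): for `η_j ≠ 0`, `1 ≤ ℓ`, and `F` of degree `≤ D` on `{0,1}^{Kℓ}`,
`#{c : F(c) = t₀ + Σ_j η_j (−1)^{p_j(c)}} ≤ 2^{Kℓ}·(1/3 + (2/3)·2^{−K} + 6·2^K·D/√ℓ)`. -/
theorem card_agree_target_le (hℓ : 1 ≤ ℓ) (t₀ : ZMod 3) (η : Fin K → ZMod 3) (hη : ∀ j, η j ≠ 0)
    {D : ℕ} {F : CubeFn (ZMod 3) (K * ℓ)} (hF : F ∈ lowDeg (ZMod 3) (K * ℓ) D) :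
    ((univ.filter fun c : Fin (K * ℓ) → Bool => F c = target t₀ η c).card : ℝ) ≤
      (2 : ℝ) ^ (K * ℓ) * (1 / 3 + 2 / 3 / (2 : ℝ) ^ K + 6 * (2 : ℝ) ^ K * D / Real.sqrt ℓ) := by
  -- split by the value `t = F c`
  have hsplit : ((univ.filter fun c : Fin (K * ℓ) → Bool => F c = target t₀ η c).card : ℝ) =
      ∑ t : ZMod 3, ∑ c : Fin (K * ℓ) → Bool, (if F c = t then (1 : ℝ) else 0) *
        (if tau t₀ η (bpar (ℓ := ℓ) c) = t then 1 else 0) := by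
    have hpt : ∀ c : Fin (K * ℓ) → Bool, (if F c = target t₀ η c then (1 : ℝ) else 0) =
        ∑ t : ZMod 3, (if F c = t then (1 : ℝ) else 0) * (if tau t₀ η (bpar (ℓ := ℓ) c) = t then 1 else 0) := by
      intro c
      rw [Finset.sum_eq_single (F c)]
      · simp only [target, if_true, one_mul]
        by_cases h : F c = tau t₀ η (bpar (ℓ := ℓ) c)
        · rw [if_pos h, if_pos h.symm]
        · rw [if_neg h, if_neg (fun h' => h h'.symm)]
      · intro t _ ht
        rw [if_neg (fun h => ht h.symm), zero_mul]
      · intro h; exact absurd (mem_univ _) h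
    rw [natCast_card_filter, Finset.sum_comm]
    exact Finset.sum_congr rfl fun c _ => hpt c
  rw [hsplit]
  -- per `t`: Walsh-expand the second indicator
  have hper : ∀ t : ZMod 3, ∑ c : Fin (K * ℓ) → Bool, (if F c = t then (1 : ℝ) else 0) *
      (if tau t₀ η (bpar (ℓ := ℓ) c) = t then 1 else 0) ≤
      (2 ^ K + 2) / (3 * 2 ^ K) * ((univ.filter fun c : Fin (K * ℓ) → Bool => F c = t).card : ℝ) +
        (2 : ℝ) ^ K * (2 * D * (2 : ℝ) ^ (K * ℓ) / Real.sqrt ℓ) := by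
    intro t
    set f : (Fin K → Bool) → ℝ := fun q => if tau t₀ η q = t then 1 else 0 with hf
    have hf01 : ∀ q, 0 ≤ f q ∧ f q ≤ 1 := fun q => by rw [hf]; dsimp only; split_ifs <;> norm_num
    -- expand
    have hexp : ∑ c : Fin (K * ℓ) → Bool, (if F c = t then (1 : ℝ) else 0) *
        (if tau t₀ η (bpar (ℓ := ℓ) c) = t then 1 else 0) =
        (1 / (2 : ℝ) ^ K) * ∑ a : Fin K → Bool, (∑ q, f q * CubeDistr.chi a q) *
          ∑ c : Fin (K * ℓ) → Bool, (if F c = t then (1 : ℝ) else 0) * CubeDistr.chi a (bpar (ℓ := ℓ) c) := by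
      calc ∑ c : Fin (K * ℓ) → Bool, (if F c = t then (1 : ℝ) else 0) *
            (if tau t₀ η (bpar (ℓ := ℓ) c) = t then 1 else 0)
          = ∑ c : Fin (K * ℓ) → Bool, (if F c = t then (1 : ℝ) else 0) *
              ((1 / (2 : ℝ) ^ K) * ∑ a : Fin K → Bool, (∑ q, f q * CubeDistr.chi a q) *
                CubeDistr.chi a (bpar (ℓ := ℓ) c)) := by
            refine Finset.sum_congr rfl fun c _ => ?_
            have hw := walsh_inversion f (bpar (ℓ := ℓ) c)
            rw [hf] at hw
            simp only at hw
            rw [hw]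
        _ = (1 / (2 : ℝ) ^ K) * ∑ a : Fin K → Bool, (∑ q, f q * CubeDistr.chi a q) *
              ∑ c : Fin (K * ℓ) → Bool, (if F c = t then (1 : ℝ) else 0) * CubeDistr.chi a (bpar (ℓ := ℓ) c) := by
            rw [Finset.mul_sum]
            simp only [Finset.mul_sum]
            rw [Finset.sum_comm]
            refine Finset.sum_congr rfl fun a _ => Finset.sum_congr rfl fun c _ => by ring
    rw [hexp]
    -- split off the trivial character
    rw [← Finset.add_sum_erase _ _ (mem_univ (fun _ : Fin K => false))]
    have hmain : (∑ q, f q * CubeDistr.chi (fun _ : Fin K => false) q) *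
        ∑ c : Fin (K * ℓ) → Bool, (if F c = t then (1 : ℝ) else 0) * CubeDistr.chi (fun _ : Fin K => false) (bpar (ℓ := ℓ) c)
        ≤ (2 ^ K + 2) / 3 * ((univ.filter fun c : Fin (K * ℓ) → Bool => F c = t).card : ℝ) := by
      simp only [chi_zero, mul_one]
      have hA : ∑ q, f q = ((univ.filter fun q : Fin K → Bool => tau t₀ η q = t).card : ℝ) := by
        rw [natCast_card_filter]
      have hB : ∑ c : Fin (K * ℓ) → Bool, (if F c = t then (1 : ℝ) else 0) =
          ((univ.filter fun c : Fin (K * ℓ) → Bool => F c = t).card : ℝ) := by rw [natCast_card_filter]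
      rw [hA, hB]
      have h3 := three_mul_card_tau_le t₀ η hη t
      have hpos : (0 : ℝ) ≤ ((univ.filter fun c : Fin (K * ℓ) → Bool => F c = t).card : ℝ) := by positivity
      nlinarith
    have herr : ∀ a ∈ (univ : Finset (Fin K → Bool)).erase (fun _ => false),
        (∑ q, f q * CubeDistr.chi a q) * ∑ c : Fin (K * ℓ) → Bool, (if F c = t then (1 : ℝ) else 0) * CubeDistr.chi a (bpar (ℓ := ℓ) c)
          ≤ (2 : ℝ) ^ K * (2 * D * (2 : ℝ) ^ (K * ℓ) / Real.sqrt ℓ) := by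
      intro a ha
      have ha0 : a ≠ fun _ => false := (mem_erase.1 ha).1
      have hX : |∑ c : Fin (K * ℓ) → Bool, (if F c = t then (1 : ℝ) else 0) * CubeDistr.chi a (bpar (ℓ := ℓ) c)| ≤
          2 * D * (2 : ℝ) ^ (K * ℓ) / Real.sqrt ℓ := by
        simp_rw [chi_bpar_eq]
        -- the union of the selected blocks is non-empty
        have hne : 1 ≤ (univ.filter fun j => a j = true).card := by
          rw [Nat.one_le_iff_ne_zero, Ne, Finset.card_eq_zero, Finset.filter_eq_empty_iff]
          intro h
          apply ha0; funext j; simpa using h (mem_univ j)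
        have hT : 1 ≤ (blockUnion (ℓ := ℓ) a).card := by rw [card_blockUnion]; nlinarith
        have hTN : (blockUnion (ℓ := ℓ) a).card ≤ K * ℓ := by
          have := Finset.card_le_univ (blockUnion (ℓ := ℓ) a); rwa [Fintype.card_fin] at this
        refine le_trans (abs_signed_corr_le hF t _ hT) ?_
        have hc := choose_half_mul_pow_le hT hTN
        have hsq : Real.sqrt ℓ ≤ Real.sqrt (blockUnion (ℓ := ℓ) a).card := by
          apply Real.sqrt_le_sqrt
          rw [card_blockUnion]; push_cast
          have : (1 : ℝ) ≤ (univ.filter fun j => a j = true).card := by exact_mod_cast hne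
          have hl : (0 : ℝ) ≤ ℓ := by positivity
          nlinarith
        have hℓpos : 0 < Real.sqrt ℓ := Real.sqrt_pos.2 (by exact_mod_cast hℓ)
        calc 2 * (D : ℝ) * ((blockUnion (ℓ := ℓ) a).card.choose ((blockUnion (ℓ := ℓ) a).card / 2)) *
              2 ^ (K * ℓ - (blockUnion (ℓ := ℓ) a).card)
            = 2 * D * (((blockUnion (ℓ := ℓ) a).card.choose ((blockUnion (ℓ := ℓ) a).card / 2) : ℝ) *
                2 ^ (K * ℓ - (blockUnion (ℓ := ℓ) a).card)) := by ring
          _ ≤ 2 * D * (2 ^ (K * ℓ) / Real.sqrt (blockUnion (ℓ := ℓ) a).card) :=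
              mul_le_mul_of_nonneg_left hc (by positivity)
          _ ≤ 2 * D * (2 ^ (K * ℓ) / Real.sqrt ℓ) := by
              apply mul_le_mul_of_nonneg_left _ (by positivity)
              exact div_le_div_of_nonneg_left (by positivity) hℓpos hsq
          _ = 2 * D * (2 : ℝ) ^ (K * ℓ) / Real.sqrt ℓ := by ring
      have hW := abs_walsh_coeff_le f hf01 a
      calc _ ≤ |(∑ q, f q * CubeDistr.chi a q)| * |∑ c : Fin (K * ℓ) → Bool, (if F c = t then (1 : ℝ) else 0) *
              CubeDistr.chi a (bpar (ℓ := ℓ) c)| := by rw [← abs_mul]; exact le_abs_self _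
        _ ≤ (2 : ℝ) ^ K * (2 * D * (2 : ℝ) ^ (K * ℓ) / Real.sqrt ℓ) :=
            mul_le_mul hW hX (abs_nonneg _) (by positivity)
    have hsum := Finset.sum_le_sum herr
    rw [sum_const, nsmul_eq_mul] at hsum
    have hcardE : (((univ : Finset (Fin K → Bool)).erase (fun _ => false)).card : ℝ) ≤ (2 : ℝ) ^ K := by
      have : ((univ : Finset (Fin K → Bool)).erase (fun _ => false)).card ≤ 2 ^ K := by
        calc _ ≤ (univ : Finset (Fin K → Bool)).card := card_erase_le
          _ = 2 ^ K := by simp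
      exact_mod_cast this
    have h2K : (0 : ℝ) < (2 : ℝ) ^ K := by positivity
    have hE0 : (0 : ℝ) ≤ (2 : ℝ) ^ K * (2 * D * (2 : ℝ) ^ (K * ℓ) / Real.sqrt ℓ) := by positivity
    calc (1 / (2 : ℝ) ^ K) * ((∑ q, f q * CubeDistr.chi (fun _ : Fin K => false) q) *
          ∑ c : Fin (K * ℓ) → Bool, (if F c = t then (1 : ℝ) else 0) * CubeDistr.chi (fun _ => false) (bpar (ℓ := ℓ) c) +
          ∑ a ∈ (univ : Finset (Fin K → Bool)).erase (fun _ => false), (∑ q, f q * CubeDistr.chi a q) *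
            ∑ c : Fin (K * ℓ) → Bool, (if F c = t then (1 : ℝ) else 0) * CubeDistr.chi a (bpar (ℓ := ℓ) c))
        ≤ (1 / (2 : ℝ) ^ K) * ((2 ^ K + 2) / 3 * ((univ.filter fun c : Fin (K * ℓ) → Bool => F c = t).card : ℝ) +
            (2 : ℝ) ^ K * ((2 : ℝ) ^ K * (2 * D * (2 : ℝ) ^ (K * ℓ) / Real.sqrt ℓ))) := by
          apply mul_le_mul_of_nonneg_left _ (by positivity)
          exact add_le_add hmain (le_trans hsum (mul_le_mul_of_nonneg_right hcardE hE0))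
      _ = _ := by field_simp
  -- sum over `t`
  have hF3 : ∑ t : ZMod 3, ((univ.filter fun c : Fin (K * ℓ) → Bool => F c = t).card : ℝ) = (2 : ℝ) ^ (K * ℓ) := by
    have h := card_eq_sum_card_fiberwise (f := F) (s := (univ : Finset (Fin (K * ℓ) → Bool))) (t := univ)
      (fun c _ => mem_univ _)
    rw [card_univ, Fintype.card_fun, Fintype.card_bool, Fintype.card_fin] at h
    have h' : ((2 ^ (K * ℓ) : ℕ) : ℝ) = ∑ t : ZMod 3, ((univ.filter fun c : Fin (K * ℓ) → Bool => F c = t).card : ℝ) := by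
      rw [h]; push_cast; rfl
    rw [← h']; push_cast; rfl
  have h3 : (Finset.univ : Finset (ZMod 3)).card = 3 := by simp
  calc ∑ t : ZMod 3, ∑ c : Fin (K * ℓ) → Bool, (if F c = t then (1 : ℝ) else 0) *
        (if tau t₀ η (bpar (ℓ := ℓ) c) = t then 1 else 0)
      ≤ ∑ t : ZMod 3, ((2 ^ K + 2) / (3 * 2 ^ K) * ((univ.filter fun c : Fin (K * ℓ) → Bool => F c = t).card : ℝ) +
          (2 : ℝ) ^ K * (2 * D * (2 : ℝ) ^ (K * ℓ) / Real.sqrt ℓ)) := Finset.sum_le_sum fun t _ => hper t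
    _ = (2 ^ K + 2) / (3 * 2 ^ K) * (2 : ℝ) ^ (K * ℓ) + 3 * ((2 : ℝ) ^ K * (2 * D * (2 : ℝ) ^ (K * ℓ) / Real.sqrt ℓ)) := by
        rw [Finset.sum_add_distrib, ← Finset.mul_sum, hF3, sum_const, h3, nsmul_eq_mul]; norm_num
    _ = (2 : ℝ) ^ (K * ℓ) * (1 / 3 + 2 / 3 / (2 : ℝ) ^ K + 6 * (2 : ℝ) ^ K * D / Real.sqrt ℓ) := by
        field_simp
        ring

end BlockParity

end Summit.QuantumAdvantage.AdviceFreeQNC0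

end
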